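import Summits.NavierStokesRegularity.NavierStokesRegularity.Theorems.SoloSalvageLin2013
import Literature.Analysis.FluidPDE.TorusClassicalNSMaximalSolution
import Literature.Analysis.FluidPDE.PeriodicGalileanNonuniqueness
import Literature.Analysis.FluidPDE.ClassicalSolutionTorusProofs
import Literature.Analysis.FunctionSpaces.FlatTorusProofs
import HarnessLib

/-!
# Solo salvage for claim C21 `Lin2013` (cell `ns-claims`, D-0090), part 2: the periodic local
# theory with the maximal alternative (Step 1) is TRUE — kernel discharge through the torus bridge

Claim skeleton: `Literature/Claims/NS/Lin2013.lean` (Qun Lin, arXiv:1308.2297 v14). Part 1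
(`SoloSalvageLin2013.lean`, seat `ns-claims-salvage-p3`) discharged `Step_3` (energy bound) and
`Step_2` (enstrophy bound ⇒ periodic continuation) and built the bridge between the claim's
ℝ³-periodic vocabulary and the tree's torus vocabulary. This file adds

* `lin2013_step1_holds : Step_1` — §1 l.325–331 / §3 l.1090 ff.: for `ν > 0` and every smooth
  divergence-free ℤ³-periodic datum, EITHER a global classical periodic solution OR a classical
  periodic solution on some `[0,T*)`, `0 < T* < ∞`, admitting no classical periodic continuation.
  Mathematics = the maximal strong solution on `𝕋³` (Robinson–Rodrigo–Sadowski 2016 §6.3 / §8.1 with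
  Thm 6.8, Lemma 6.11, Thm 6.10), in the tree as `Torus.exists_maximal_classicalNS` (mean-zero data);
  bridge = descent of the datum and subtraction of its mean, lift + inverse Galilean boost
  (`isPeriodicClassicalOn_lift_unboost`; Majda–Bertozzi 2002 §1.2), and — for maximality — boost +
  descent of a putative periodic continuation (`exists_torus_of_isPeriodicClassicalOn`), which the
  torus maximality clause excludes.

With parts 1–2 and the skeleton's `step4_holds`, EVERY step of C21 before the adjudicated locator
`Step_5` is kernel-true.

Solo lane (`Theorems/SoloSalvage<Slug>….lean`, no item).

WHAT THIS IS NOT: not a claim about NS regularity or blow-up; not a claim about any author beyond the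
typed locator.
-/

noncomputable section

-- The summit-side namespace repeats the summit name by design (D-0017 layout); tree precedent
-- `SoloSalvageLam2019.lean`.
set_option linter.dupNamespace false

open MeasureTheory Set Filter
open scoped InnerProductSpace ContDiff

namespace Summit.NavierStokesRegularity.NavierStokesRegularity.Theorems.Lin2013Salvage

open Literature.Analysis.FluidPDE Literature.Analysis.FunctionSpaces Literature.Claims.NS.Lin2013

/-! ### Lift and inverse boost -/

/-- Lifting a torus solution on a time set of unique differentiability and undoing a Galilean boost
by `m₀` gives a classical ℤ³-periodic solution on `ℝ³` (`of_torus_holds`, `galileanBoost_const`,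
`isLatticePeriodic_lift`). -/
theorem isPeriodicClassicalOn_lift_unboost {S : Set ℝ} (hS : UniqueDiffOn ℝ S) {ν : ℝ}
    {U : ℝ → UnitAddTorus (Fin 3) → (EuclideanSpace ℝ (Fin 3))} {P : ℝ → UnitAddTorus (Fin 3) → ℝ}
    (hU : Torus.IsClassicalNSSolutionOn S ν 0 U P) (m₀ : (EuclideanSpace ℝ (Fin 3))) :
    IsPeriodicClassicalOn S ν (fun t y => Torus.lift (U t) (y + t • (-m₀)) - (-m₀))
      (fun t y => Torus.lift (P t) (y + t • (-m₀))) := by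
  have hlift : IsClassicalNSSolutionOn S ν
      (fun t => Torus.lift ((0 : ℝ → UnitAddTorus (Fin 3) → (EuclideanSpace ℝ (Fin 3))) t))
      (fun t => Torus.lift (U t)) (fun t => Torus.lift (P t)) :=
    IsClassicalNSSolutionOn.of_torus_holds hU
  have hlift0 : IsClassicalNSSolutionOn S ν 0 (fun t => Torus.lift (U t))
      (fun t => Torus.lift (P t)) := by
    have h0 : (fun t => Torus.lift ((0 : ℝ → UnitAddTorus (Fin 3) → (EuclideanSpace ℝ (Fin 3))) t)) =
        (0 : ℝ → (EuclideanSpace ℝ (Fin 3)) → (EuclideanSpace ℝ (Fin 3))) := by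
      funext t x
      simp [Torus.lift_apply]
    rw [h0] at hlift
    exact hlift
  refine ⟨hlift0.galileanBoost_const hS (-m₀), fun t _ => ⟨?_, ?_⟩⟩
  · have hp : IsLatticePeriodic (Torus.lift (U t)) := fun j x => Torus.isLatticePeriodic_lift (U t) j x
    exact (hp.comp_add_right (t • (-m₀))).sub_const (-m₀)
  · have hp : IsLatticePeriodic (Torus.lift (P t)) := fun j x => Torus.isLatticePeriodic_lift (P t) j x
    exact hp.comp_add_right (t • (-m₀))

/-! ### Step 1 holds -/

/-- **`Step_1` holds** (§1 l.325–331, §3 l.1090 ff.: local existence and the maximal development for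
the periodic problem): for `ν > 0` and a smooth divergence-free ℤ³-periodic datum, EITHER a global
classical periodic solution, OR a classical periodic solution on some `[0,T*)`, `0 < T* < ∞`, with no
classical periodic continuation past `T*`. Proof: descend the datum to `𝕋³` and subtract its mean
`m₀`; the torus dichotomy `Torus.exists_maximal_classicalNS` (RRS 2016 §6.3/§8.1) gives a global or
a maximal mean-zero solution `U`; `lift U(t)(· − t m₀) + m₀` is the periodic solution on `ℝ³`
(`isPeriodicClassicalOn_lift_unboost`); a periodic continuation past `T*` would, boosted by `m₀` and
descended (`exists_torus_of_isPeriodicClassicalOn`), be a torus classical solution through the same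
datum on `[0,b]` with `b > T*`, which the maximality clause forbids. -/
theorem lin2013_step1_holds : Literature.Claims.NS.Lin2013.Step_1 := by
  intro ν hν u₀ hu₀ hdiv hper
  -- descend the datum and remove its mean
  have hperT : Torus.IsLatticePeriodic u₀ := fun j x => hper j x
  set U₀ : UnitAddTorus (Fin 3) → (EuclideanSpace ℝ (Fin 3)) := Torus.descend u₀ hperT with hU₀
  have hliftU₀ : Torus.lift U₀ = u₀ := Torus.lift_descend_holds u₀ hperT
  set m₀ : (EuclideanSpace ℝ (Fin 3)) := ∫ y, U₀ y with hm₀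
  set V₀ : UnitAddTorus (Fin 3) → (EuclideanSpace ℝ (Fin 3)) := fun x => U₀ x - m₀ with hV₀
  have hliftV₀ : Torus.lift V₀ = fun y => u₀ y - m₀ := by
    funext y
    show U₀ (Torus.proj y) - m₀ = u₀ y - m₀
    rw [← Torus.lift_apply U₀ y, hliftU₀]
  have hU₀smooth : Torus.IsSmooth U₀ := by
    show ContDiff ℝ ∞ (Torus.lift U₀)
    rw [hliftU₀]
    exact hu₀
  have hV₀smooth : Torus.IsSmooth V₀ := by
    show ContDiff ℝ ∞ (Torus.lift V₀)
    rw [hliftV₀]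
    exact hu₀.sub contDiff_const
  have hV₀div : Torus.IsDivFree V₀ := by
    have h1 : VectorCalculus.IsDivFree (Torus.lift V₀) := by
      rw [hliftV₀]
      intro x
      have h := hdiv x
      unfold NSWave0.divergence at h
      unfold VectorCalculus.divergence
      rw [fderiv_sub_const]
      exact h
    exact (isDivFree_lift_iff (hV₀smooth.isContDiff (by simp))).1 h1
  have hV₀mean : Torus.HasZeroMean V₀ := by
    unfold Torus.HasZeroMean
    show ∫ x, (U₀ x - m₀) = 0
    rw [integral_sub hU₀smooth.integrable (integrable_const m₀), integral_const, probReal_univ,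
      one_smul, hm₀, sub_self]
  -- the maximal solution on `𝕋³`
  obtain ⟨U, P, hU0, hcases⟩ :=
    Torus.exists_maximal_classicalNS (d := Fin 3) (by simp) hν hV₀smooth hV₀div hV₀mean
  -- the periodic solution on `ℝ³`: lift and undo the boost by `m₀`
  set w : ℝ → (EuclideanSpace ℝ (Fin 3)) → (EuclideanSpace ℝ (Fin 3)) :=
    fun t y => Torus.lift (U t) (y + t • (-m₀)) - (-m₀) with hw
  set q : ℝ → (EuclideanSpace ℝ (Fin 3)) → ℝ := fun t y => Torus.lift (P t) (y + t • (-m₀)) with hq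
  have hw0 : w 0 = u₀ := by
    funext y
    show Torus.lift (U 0) (y + (0 : ℝ) • (-m₀)) - (-m₀) = u₀ y
    rw [zero_smul, add_zero, hU0, hliftV₀]
    show u₀ y - m₀ - (-m₀) = u₀ y
    rw [sub_neg_eq_add, sub_add_cancel]
  rcases hcases with ⟨hUglob, -, -⟩ | ⟨T, hT, hUsol, -, -, hmax⟩
  · -- global branch
    exact Or.inl ⟨w, q, isPeriodicClassicalOn_lift_unboost (uniqueDiffOn_Ici 0) hUglob m₀, hw0⟩
  · -- maximal branch
    refine Or.inr ⟨T, hT, w, q, isPeriodicClassicalOn_lift_unboost (uniqueDiffOn_Ico 0 T) hUsol m₀,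
      hw0, ?_⟩
    rintro ⟨T'', hTT'', u', p', hsol', hagree'⟩
    -- boost the putative continuation by `m₀` and descend it
    have hper' := hsol'.2
    have hsol'₁ : IsPeriodicClassicalOn (Ico 0 T'') ν (fun t y => u' t (y + t • m₀) - m₀)
        (fun t y => p' t (y + t • m₀)) := by
      refine ⟨hsol'.1.galileanBoost_const_Ico m₀, fun t ht => ⟨?_, ?_⟩⟩
      · exact ((hper' t ht).1.comp_add_right (t • m₀)).sub_const m₀
      · exact (hper' t ht).2.comp_add_right (t • m₀)
    obtain ⟨U', P', hU', hu'U, -⟩ := exists_torus_of_isPeriodicClassicalOn hsol'₁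
    -- a closed window `[0, b]` with `T < b < T''`
    set b : ℝ := (T + T'') / 2 with hb
    have hTb : T < b := by rw [hb]; linarith
    have hbT'' : b < T'' := by rw [hb]; linarith
    have hb0 : 0 < b := hT.trans hTb
    have hU'b : Torus.IsClassicalNSSolutionOn (Icc 0 b) ν 0 U' P' :=
      hU'.mono (fun t ht => ⟨ht.1, ht.2.trans_lt hbT''⟩) (uniqueDiffOn_Icc hb0)
    -- same datum
    have hU'0 : U' 0 = V₀ := by
      apply Torus.lift_injective
      have h0'' : (0 : ℝ) ∈ Ico 0 T'' := ⟨le_rfl, hT.trans hTT''⟩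
      rw [← hu'U 0 h0'', hliftV₀]
      funext y
      show u' 0 (y + (0 : ℝ) • m₀) - m₀ = u₀ y - m₀
      rw [zero_smul, add_zero, hagree' 0 ⟨le_rfl, hT⟩, hw0]
    exact absurd (hmax b U' P' hU'b hU'0).1 (not_lt.2 hTb.le)

end Summit.NavierStokesRegularity.NavierStokesRegularity.Theorems.Lin2013Salvage

end
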